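import Summits.PneNP.PneNP.Theses.KarlinRubin
import Literature.Computability.Complexity.PeresNoiseSensitivity

/-!
# Crux-ideate sketch — stmt-PneNP-18027 `MonotoneBlind` (route PneNP/KarlinRubin, crux #3), round 1, ideator 1

Typed first lemmas for two idea cards. Everything is either a `def … : Prop` signature or a
kernel-checked theorem; nothing is `sorry`. PROVED here (axioms propext / Classical.choice / Quot.sound):
`sum_influence_le` (total influence of a monotone graph function `≤ √C(n,2)`, from the in-tree unate
bound), `fairShare` (the fair-share benchmark under any forced set), `shapeGap_iff`, `stageSplit`
(seams), `flipFlowIdentity_holds` (the exact flip-flow identity at a weighted monotone threshold gate).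

* **Card `respray-shape-gap`** — §1–§3: the respray lemma (random-position edges are free for every
  monotone function, from the in-tree unate total-influence bound
  `Literature.Computability.Complexity.unate_sum_card_pivotal_le`; one-step form PROVED as `fairShare`),
  decoy absorption (second moment), the SHAPE form of the crux and its seam (`shapeGap_iff`, proved), the
  ignition identity (Russo along the clique-deletion path), the early/late stage split and its seam
  (`stageSplit`, proved).
* **Card `threshold-flow-read-once`** — §4: weighted monotone threshold formulas over the edges of
  `K_n`, the exact flip-flow identity at one threshold gate (`flipFlowIdentity_holds`, PROVED), and the
  rung "read-once monotone threshold formulas are blind below `√n`" (`ReadOnceBlindAt`).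

Counting form throughout (finite averages over `EdgeVec n`, `kSubsets`, `powersetCard`), as in
`Literature/Computability/Complexity/RossmanMonotoneClique.lean`; the PMF form of the route file is
recovered by `PMF.uniformOfFintype` / `uniformOfFinset` bookkeeping (not done here).
-/

set_option linter.dupNamespace false
set_option autoImplicit false

noncomputable section

namespace Summit.PneNP.PneNP.Cruxes.MonotoneBlind.Ideas

open Literature.Computability.Complexity Literature.Probability.RandomGraphs.PlantedClique
open Finset Filter

/-! ## §0 Counting-form vocabulary -/

/-- Potential edges of `K_n`. -/
abbrev Edge (n : ℕ) : Type := (⊤ : SimpleGraph (Fin n)).edgeSet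

variable {n : ℕ}

open Classical in
/-- Force the edges of `F` on (a restriction / "planting an edge set"). -/
def forceOn (F : Finset (Edge n)) (x : EdgeVec n) : EdgeVec n := fun e => x e || decide (e ∈ F)

/-- `forceOn` is monotone in the input graph. -/
theorem forceOn_mono (F : Finset (Edge n)) : Monotone (forceOn F) := by
  intro x y hxy e
  simp only [forceOn]
  have := hxy e
  revert this
  cases x e <;> cases y e <;> simp

open Classical in
/-- The `C(|S|,2)` potential edges inside a vertex set `S`. -/
def edgesOf (S : Finset (Fin n)) : Finset (Edge n) :=
  univ.filter fun e => ∀ v ∈ (e : Sym2 (Fin n)), v ∈ S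

/-- Uniform (= `G(n,1/2)`) probability of an event, counting form. -/
def unifProb (n : ℕ) (P : EdgeVec n → Prop) [DecidablePred P] : ℝ :=
  ((univ.filter P).card : ℝ) / (Fintype.card (EdgeVec n) : ℝ)

/-- `|EdgeVec n| = 2^{C(n,2)}`. -/
theorem card_edgeVec (n : ℕ) : (Fintype.card (EdgeVec n) : ℝ) = (2 : ℝ) ^ Fintype.card (Edge n) := by
  simp [EdgeVec]

/-- Uniform average of a real function over a finite set (junk `0/0 = 0` on the empty set). -/
def avgOver {α : Type*} (T : Finset α) (f : α → ℝ) : ℝ := (∑ a ∈ T, f a) / (T.card : ℝ)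

/-- Planted clique size `k(n) = ⌈n^{1/2-δ}⌉` of the crux. -/
def kOf (δ : ℝ) (n : ℕ) : ℕ := ⌈(n : ℝ) ^ (1 / 2 - δ)⌉₊

/-- Number of planted edges `M(n) = C(min(k,n), 2)` (the `min` matches `kSubsets`). -/
def mOf (δ : ℝ) (n : ℕ) : ℕ := (min (kOf δ n) n).choose 2

/-- `Pr_{G(n,1/2)}[f = 1]`. -/
def nullAcc (n : ℕ) (f : EdgeVec n → Bool) : ℝ := unifProb n fun x => f x = true

/-- `Pr_{A,x}[f(x ∪ K_A) = 1]`, `A` a uniform `min(k,n)`-set (counting form of `plantedCliqueDist`). -/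
def plantedAcc (n k : ℕ) (f : EdgeVec n → Bool) : ℝ :=
  avgOver (kSubsets n k) fun S => unifProb n fun x => f (plant S x) = true

/-- DECOY acceptance: `Pr_{D,x}[f(x ∪ D) = 1]`, `D` a uniformly random set of `M` potential edges
(position-free mass equal to one clique's worth). -/
def decoyAcc (n M : ℕ) (f : EdgeVec n → Bool) : ℝ :=
  avgOver (univ.powersetCard M) fun D => unifProb n fun x => f (forceOn D x) = true

/-- PARTIAL planting: `Pr_{A,Q,x}[f(x ∪ Q) = 1]` with `Q` a uniform `m`-subset of `E(A)` (the stage-`m`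
hybrid of the clique-deletion path; `m = M` is `plantedAcc`, `m = 0` is `nullAcc`). -/
def partialPlantedAcc (n k m : ℕ) (f : EdgeVec n → Bool) : ℝ :=
  avgOver (kSubsets n k) fun S => avgOver ((edgesOf S).powersetCard m) fun Q =>
    unifProb n fun x => f (forceOn Q x) = true

/-- A monotone `{∧₂,∨₂,0,1}`-family of size `≤ n^c` eventually (the class the crux quantifies over). -/
def SmallMonotone (c : ℕ) (C : (n : ℕ) → Circuit (Edge n)) : Prop :=
  ∀ᶠ n : ℕ in atTop, (C n).IsOver monotoneBasis01 ∧ (C n).size ≤ n ^ c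

/-- The crux at one exponent, counting/advantage form: no small monotone family has
`Pr_planted[C = 1] − Pr_null[C = 1] → 1` (equivalently error sum `→ 0`; cf. the census's
`StrategyCensus.MonotoneBlindAt`, PMF form). -/
def MonotoneBlindAt' (δ : ℝ) : Prop :=
  ∀ c : ℕ, ¬ ∃ C : (n : ℕ) → Circuit (Edge n), SmallMonotone c C ∧
    Tendsto (fun n => plantedAcc n (kOf δ n) (C n).eval - nullAcc n (C n).eval) atTop (nhds 1)

/-! ## §1 Card `respray-shape-gap`: random-position edges are free; the crux is a SHAPE statement -/

/-- `e` is pivotal for `f` at `x`. -/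
abbrev Pivotal (f : EdgeVec n → Bool) (x : EdgeVec n) (e : Edge n) : Prop :=
  f (Function.update x e true) ≠ f (Function.update x e false)

/-- Influence of `e` on `f` under `G(n,1/2)`. -/
def influence (n : ℕ) (f : EdgeVec n → Bool) (e : Edge n) : ℝ := unifProb n fun x => Pivotal f x e

/-- Influences are nonnegative. -/
theorem influence_nonneg (f : EdgeVec n → Bool) (e : Edge n) : 0 ≤ influence n f e := by
  unfold influence unifProb
  positivity

/-- Pivotality of `e` at `x` is "flipping `e` at `x` changes `f`". -/
theorem pivotal_iff_flip (f : EdgeVec n → Bool) (x : EdgeVec n) (e : Edge n) :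
    Pivotal f x e ↔ f x ≠ f (Function.update x e (!x e)) := by
  unfold Pivotal
  cases h : x e
  · have hx : Function.update x e false = x := by rw [← h, Function.update_eq_self]
    rw [hx]
    simp only [Bool.not_false]
    exact ne_comm
  · have hx : Function.update x e true = x := by rw [← h, Function.update_eq_self]
    rw [hx]
    simp only [Bool.not_true]

/-- **Total influence of a monotone graph function is at most `√C(n,2)`** — the in-tree unate bound
`unate_sum_card_pivotal_le` (O'Donnell Ex. 2.23) moved to the counting-form `influence`. PROVED. -/
theorem sum_influence_le (f : EdgeVec n → Bool) (hf : Monotone f) :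
    ∑ e : Edge n, influence n f e ≤ Real.sqrt (Fintype.card (Edge n)) := by
  unfold influence unifProb
  rw [← Finset.sum_div, card_edgeVec, div_le_iff₀ (by positivity)]
  have hswap : (∑ e : Edge n, ((univ.filter fun x : EdgeVec n => Pivotal f x e).card : ℝ)) =
      ∑ x : EdgeVec n, ((univ.filter fun e : Edge n => f x ≠ f (Function.update x e (!x e))).card : ℝ) := by
    simp only [Finset.card_eq_sum_ones, Nat.cast_sum, Finset.sum_filter]
    rw [Finset.sum_comm]
    refine Finset.sum_congr rfl fun x _ => Finset.sum_congr rfl fun e _ => ?_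
    exact congrArg _ (if_congr (pivotal_iff_flip f x e) rfl rfl)
  rw [hswap]
  refine unate_sum_card_pivotal_le f fun j => Or.inl fun ω h => ?_
  have hle : f (Function.update ω j false) ≤ f (Function.update ω j true) :=
    hf (update_le_update_iff'.2 (Bool.false_le _))
  rw [h] at hle
  revert hle
  cases f (Function.update ω j true) <;> simp

/-- **RESPRAY LEMMA** (first lemma of the card; provable NOW, size S–M). For EVERY monotone `f` (no size
bound), every forced set `F` and every `m`: spraying `m` uniformly random further edges raises
`Pr[f = 1]` by at most `m / √(N − |F| − m)`. Proof: telescope one sprayed edge at a time; at each step the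
new edge is uniform among the free coordinates of the restricted (still monotone, hence unate) function
`f ∘ forceOn F'`, whose total influence is `≤ √#free` by `unate_sum_card_pivotal_le` (O'Donnell Ex. 2.23,
in the tree); a uniformly random free coordinate is therefore pivotal w.p. `≤ 1/√#free`. With
`m = M = C(k,2) ≈ n^{1−2δ}/2` and `N = C(n,2)`: total `≤ 0.71·n^{−2δ} → 0`. -/
def ResprayBound : Prop :=
  ∀ (n : ℕ) (f : EdgeVec n → Bool), Monotone f → ∀ (F : Finset (Edge n)) (m : ℕ),
    m + F.card < Fintype.card (Edge n) →
    avgOver ((univ \ F).powersetCard m) (fun D => unifProb n fun x => f (forceOn (F ∪ D) x) = true)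
        - unifProb n (fun x => f (forceOn F x) = true)
      ≤ (m : ℝ) / Real.sqrt ((Fintype.card (Edge n) : ℝ) - F.card - m)

/-- **DECOY ABSORPTION** (provable now, M: one Cauchy–Schwarz with the in-tree planting tools of
`GnpPlantedLikelihoodRatio`): adding `M(n) = C(k,2)` uniformly random edges to `G(n,1/2)` is invisible to
EVERY test `T` (not only monotone ones): `E[L²] = E_{D,D'} 2^{|D ∩ D'|} ≤ exp(M²/(N−M)) → 1` since
`M²/N ≈ n^{−4δ}/2`. -/
def DecoyAbsorbed (δ : ℝ) : Prop :=
  ∀ T : (n : ℕ) → EdgeVec n → Bool,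
    Tendsto (fun n => decoyAcc n (mOf δ n) (T n) - nullAcc n (T n)) atTop (nhds 0)

/-- **SHAPE GAP** — the crux with the null replaced by the mass-matched decoy: no small monotone family
separates "a clique's worth of edges in clique SHAPE" from "a clique's worth of edges at uniformly random
POSITIONS" with advantage `→ 1`. Every threshold of an exchangeable statistic (edge count; and, after
averaging over the clique position, degree / co-degree profiles) has shape gap EXACTLY `0` resp. `o(1)`:
the B3 obstruction (threshold-nativity) is neutral in this form by symmetry, not by accounting. -/
def ShapeGapAt (δ : ℝ) : Prop :=
  ∀ c : ℕ, ¬ ∃ C : (n : ℕ) → Circuit (Edge n), SmallMonotone c C ∧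
    Tendsto (fun n => plantedAcc n (kOf δ n) (C n).eval - decoyAcc n (mOf δ n) (C n).eval) atTop (nhds 1)

/-- Seam (kernel-checked): given decoy absorption, the SHAPE form is EQUIVALENT to the crux at `δ`. -/
theorem shapeGap_iff {δ : ℝ} (hD : DecoyAbsorbed δ) : ShapeGapAt δ ↔ MonotoneBlindAt' δ := by
  constructor
  · intro h c ⟨C, hC, hT⟩
    refine h c ⟨C, hC, ?_⟩
    have h0 := hD (fun n => (C n).eval)
    have := hT.sub h0
    simp only [sub_zero] at this
    refine this.congr' (Eventually.of_forall fun n => ?_)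
    simp only
    ring
  · intro h c ⟨C, hC, hT⟩
    refine h c ⟨C, hC, ?_⟩
    have h0 := hD (fun n => (C n).eval)
    have := hT.add h0
    simp only [add_zero] at this
    refine this.congr' (Eventually.of_forall fun n => ?_)
    simp only
    ring

/-! ## §2 Card `respray-shape-gap`: the ignition identity and its fair-share benchmark -/

/-- **IGNITION** `Ign(f)`: sum over the stages `m < M` of the clique-deletion path of the mean influence,
under the stage-`m` measure (`Q_m ⊆ E(A)` forced, `|Q_m| = m`, rest fair), of a uniformly random UNPLANTED
pair of the planted `k`-set `A`. -/
def ignition (n k : ℕ) (f : EdgeVec n → Bool) : ℝ :=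
  ∑ m ∈ range ((min k n).choose 2),
    avgOver (kSubsets n k) fun S => avgOver ((edgesOf S).powersetCard m) fun Q =>
      avgOver (edgesOf S \ Q) fun e => influence n (fun x => f (forceOn Q x)) e

/-- **IGNITION IDENTITY** (Russo along the clique-deletion path; provable now, M): for monotone `f`,
`Pr_planted[f=1] − Pr_null[f=1] = ½·Ign(f)` EXACTLY (`forceOn (E S) = plant S`, `forceOn ∅ = id`, and
the stage increment is `½·E[Inf]` because pivotality does not read the resampled coordinate).
Consequence: the crux at `δ` ⟺ `Ign(C_n) ↛ 2` for small monotone families — a statement about ONE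
circuit along a RANDOM growing clique (census S2's prescription), union-bound-free (census S3's failure
mode absent), violated by the counter-model `f⋆ = (Thr ∧ CLIQUE_k) ∨ Thr'` ONLY through its `CLIQUE_k`
factor (B2-compliant), and satisfied with ratio `1` by every threshold of an exchangeable statistic
(B3 neutral by symmetry). -/
def IgnitionIdentity : Prop :=
  ∀ (n k : ℕ) (f : EdgeVec n → Bool), Monotone f →
    plantedAcc n k f - nullAcc n f = (1 / 2) * ignition n k f

/-- **FAIR-SHARE BENCHMARK** (provable now from `unate_sum_card_pivotal_le`, S): under ANY stage measure
the mean influence of a uniformly random FREE pair is `≤ 1/√#free ≤ √2/(n−1)·(1+o(1))`. Hence if in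
`Ign` the unplanted CLIQUE pair were replaced by a uniformly random free pair, the sum would be
`≤ M·√2/n ≈ 0.71·n^{−2δ}`: detection below `√n` ⟺ the partially planted hidden `k`-block attracts
influence density `≳ n^{2δ}` times the fair share, averaged along the path (BINC, see the card). The
exponent `2δ = log_n(n/k²)` is EXACTLY the room; at `k = Θ(√n)` the fair share itself suffices —
Kučera's threshold read off the unate influence bound. -/
def FairShareBenchmark : Prop :=
  ∀ (n : ℕ) (g : EdgeVec n → Bool), Monotone g → ∀ F : Finset (Edge n), F.card < Fintype.card (Edge n) →
    avgOver (univ \ F) (fun e => influence n (fun x => g (forceOn F x)) e)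
      ≤ 1 / Real.sqrt ((Fintype.card (Edge n) : ℝ) - F.card)

/-- **FAIR SHARE, proved form** (constant `√N/(N−|F|)` instead of `1/√(N−|F|)`, the same for `|F| = o(N)`):
under the stage measure `forceOn F`, the mean influence of a uniformly random FREE pair of ANY monotone `g`
is `≤ √N/(N − |F|) ≈ √2/n`. PROVED from `sum_influence_le`. -/
theorem fairShare (g : EdgeVec n → Bool) (hg : Monotone g) (F : Finset (Edge n))
    (hF : F.card < Fintype.card (Edge n)) :
    avgOver (univ \ F) (fun e => influence n (fun x => g (forceOn F x)) e)
      ≤ Real.sqrt (Fintype.card (Edge n)) / ((Fintype.card (Edge n) : ℝ) - F.card) := by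
  have hmono : Monotone fun x => g (forceOn F x) := hg.comp (forceOn_mono F)
  have hsum := sum_influence_le (fun x => g (forceOn F x)) hmono
  have hcard : ((univ \ F).card : ℝ) = (Fintype.card (Edge n) : ℝ) - F.card := by
    rw [Finset.card_univ_sdiff, Nat.cast_sub hF.le]
  have hpos : (0 : ℝ) < (Fintype.card (Edge n) : ℝ) - F.card := by
    have : (F.card : ℝ) < Fintype.card (Edge n) := by exact_mod_cast hF
    linarith
  unfold avgOver
  rw [hcard, div_le_div_iff_of_pos_right hpos]
  calc ∑ e ∈ univ \ F, influence n (fun x => g (forceOn F x)) e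
      ≤ ∑ e : Edge n, influence n (fun x => g (forceOn F x)) e :=
        Finset.sum_le_sum_of_subset_of_nonneg (Finset.subset_univ _) fun e _ _ => influence_nonneg _ e
    _ ≤ Real.sqrt (Fintype.card (Edge n)) := hsum

/-! ## §3 Card `respray-shape-gap`: the early / late stage split (two strictly weaker open pieces) -/

/-- **EARLY BLINDNESS** at intra-density `1 − η/2`-ish: planting a uniformly random `⌊(1−η)M⌋`-subset of
`E(A)` (a planted `G(k, 1−η)`-like dense block, NOT a clique) is invisible to small monotone families.
Per instance strictly WEAKER than the crux (less is planted); the planted object is itself random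
(second-moment / conditional tools available that a deterministic clique lacks). -/
def EarlyBlindAt (δ η : ℝ) : Prop :=
  ∀ c : ℕ, ∀ C : (n : ℕ) → Circuit (Edge n), SmallMonotone c C →
    Tendsto (fun n => partialPlantedAcc n (kOf δ n) ⌊(1 - η) * mOf δ n⌋₊ (C n).eval - nullAcc n (C n).eval)
      atTop (nhds 0)

/-- **LATE GAP** (completion): no small monotone family tells the full planted clique from the same clique
with a uniformly random `η`-fraction of its pairs left fair, with advantage `→ 1` ("small monotone
circuits cannot check COMPLETENESS of a hidden near-clique"; `f⋆` lives entirely here, brute force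
`CLIQUE_{3 log n}` entirely in the early piece). Strictly weaker than the crux. -/
def LateGapAt (δ η : ℝ) : Prop :=
  ∀ c : ℕ, ¬ ∃ C : (n : ℕ) → Circuit (Edge n), SmallMonotone c C ∧
    Tendsto (fun n => plantedAcc n (kOf δ n) (C n).eval
        - partialPlantedAcc n (kOf δ n) ⌊(1 - η) * mOf δ n⌋₊ (C n).eval) atTop (nhds 1)

/-- Seam (kernel-checked): EARLY ∧ LATE ⟹ the crux at `δ` (for any split point `η`). -/
theorem stageSplit {δ η : ℝ} (hE : EarlyBlindAt δ η) (hL : LateGapAt δ η) : MonotoneBlindAt' δ := by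
  intro c ⟨C, hC, hT⟩
  refine hL c ⟨C, hC, ?_⟩
  have h0 := hE c C hC
  have := hT.sub h0
  simp only [sub_zero] at this
  refine this.congr' (Eventually.of_forall fun n => ?_)
  simp only
  ring

/-! ## §4 Card `threshold-flow-read-once`: exact flip flow through threshold gates -/

/-- Weighted monotone THRESHOLD FORMULAS over the potential edges of `K_n` (unbounded fan-in; `θ = 1` is
OR, `θ = Σ w` is AND; `{∧₂,∨₂}`-circuits of fan-out one are the binary case). -/
inductive TF (n : ℕ) : Type
  | leaf : Edge n → TF n
  | gate : ℕ → List (ℕ × TF n) → TF n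

mutual
/-- Evaluation of a threshold formula. -/
def TF.eval {n : ℕ} : TF n → EdgeVec n → Bool
  | .leaf e, x => x e
  | .gate θ cs, x => decide (θ ≤ TF.wsum cs x)
/-- Weighted number of true children. -/
def TF.wsum {n : ℕ} : List (ℕ × TF n) → EdgeVec n → ℕ
  | [], _ => 0
  | (w, F) :: cs, x => (if TF.eval F x then w else 0) + TF.wsum cs x
end

mutual
/-- The multiset of leaves (with repetition) of a threshold formula. -/
def TF.leaves {n : ℕ} : TF n → List (Edge n)
  | .leaf e => [e]
  | .gate _ cs => TF.leavesL cs
/-- Leaves of a list of weighted children. -/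
def TF.leavesL {n : ℕ} : List (ℕ × TF n) → List (Edge n)
  | [] => []
  | (_, F) :: cs => TF.leaves F ++ TF.leavesL cs
end

/-- READ-ONCE: every potential edge is read by at most one leaf (so children of every gate depend on
disjoint edge sets and are independent under `G(n,1/2)`, also conditionally on the planted set). -/
def TF.ReadOnce {n : ℕ} (F : TF n) : Prop := F.leaves.Nodup

/-- **FLIP-FLOW IDENTITY at one threshold gate** (provable now, S; pure counting). On any finite sample
space, for children `g_i ≤ g_i'` (before / after planting), weights `w`, threshold `θ`: the gate flips
iff EXACTLY ONE hybrid index `l` crosses, i.e.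
`#{θ ≤ Σ w g' ∧ Σ w g < θ} = Σ_l #{g_l = 0 ∧ g_l' = 1 ∧ Y⁽ˡ⁻¹⁾ ∈ [θ − w_l, θ)}` with the hybrid sum
`Y⁽ˡ⁻¹⁾ = Σ_{i<l} w_i g_i' + Σ_{i≥l} w_i g_i`. Dividing by `|Ω|`: `flip(gate) = Σ_l Pr[child l flips ∧
hybrid siblings critical]`; for INDEPENDENT children this factors as `Σ_l flip(g_l)·atom_l`
(advantage flows from the leaves, attenuated at every gate by a local atom of the sibling sum — the
modular-valuation facts `fprm_adv_*` of Cruxes/ConstantBand with the slack made explicit). -/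
def FlipFlowIdentity : Prop :=
  ∀ (Ω : Type) [Fintype Ω] (s θ : ℕ) (w : Fin s → ℕ) (g g' : Fin s → Ω → Bool),
    (∀ i ω, g i ω = true → g' i ω = true) →
    (univ.filter fun ω : Ω =>
        θ ≤ (∑ i, if g' i ω then w i else 0) ∧ (∑ i, if g i ω then w i else 0) < θ).card
      = ∑ l : Fin s, (univ.filter fun ω : Ω =>
          g l ω = false ∧ g' l ω = true ∧
          θ ≤ (∑ i, if (if i < l then g' i ω else g i ω) then w i else 0) + w l ∧
          (∑ i, if (if i < l then g' i ω else g i ω) then w i else 0) < θ).card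

/-! ### Proof of the flip-flow identity -/

section FlipFlowProof

variable {Ω : Type} {s : ℕ} (θ : ℕ) (w : Fin s → ℕ) (g g' : Fin s → Ω → Bool) (ω : Ω)

/-- The `l`-th hybrid weighted sum at `ω` (children `< l` planted, `≥ l` unplanted), `l : ℕ`. -/
def hyb (l : ℕ) : ℕ := ∑ i : Fin s, if (if (i : ℕ) < l then g' i ω else g i ω) then w i else 0

theorem hyb_zero : hyb w g g' ω 0 = ∑ i : Fin s, if g i ω then w i else 0 := by
  simp [hyb]

theorem hyb_top : hyb w g g' ω s = ∑ i : Fin s, if g' i ω then w i else 0 := by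
  unfold hyb
  refine Finset.sum_congr rfl fun i _ => ?_
  simp [i.isLt]

/-- One hybrid step adds `w l` exactly when child `l` flips. -/
theorem hyb_succ (hmono : ∀ i ω, g i ω = true → g' i ω = true) (l : Fin s) :
    hyb w g g' ω (l + 1) = hyb w g g' ω l + (if g l ω = false ∧ g' l ω = true then w l else 0) := by
  unfold hyb
  have key : ∀ i : Fin s, (if (if (i : ℕ) < (l : ℕ) + 1 then g' i ω else g i ω) then w i else 0)
      = (if (if (i : ℕ) < (l : ℕ) then g' i ω else g i ω) then w i else 0)
        + (if i = l then (if g i ω = false ∧ g' i ω = true then w i else 0) else 0) := by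
    intro i
    by_cases hil : i = l
    · subst hil
      have h1 : (i : ℕ) < (i : ℕ) + 1 := Nat.lt_succ_self _
      have h2 : ¬ (i : ℕ) < (i : ℕ) := lt_irrefl _
      simp only [h1, h2, if_true, if_false]
      have hm := hmono i ω
      cases hg : g i ω <;> cases hg' : g' i ω <;> simp_all
    · have hne : (i : ℕ) ≠ (l : ℕ) := fun h => hil (Fin.ext h)
      have hiff : ((i : ℕ) < (l : ℕ) + 1) ↔ ((i : ℕ) < (l : ℕ)) := by omega
      simp only [hil, if_false, add_zero]
      by_cases h : (i : ℕ) < (l : ℕ)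
      · simp [h, hiff.2 h]
      · have h' : ¬ (i : ℕ) < (l : ℕ) + 1 := fun h'' => h (hiff.1 h'')
        simp [h, h']
  rw [Finset.sum_congr rfl fun i _ => key i, Finset.sum_add_distrib]
  congr 1
  rw [Finset.sum_ite_eq' univ l]
  simp

/-- Beyond `s` the hybrid sum is constant. -/
theorem hyb_of_le {l : ℕ} (hl : s ≤ l) : hyb w g g' ω l = hyb w g g' ω s := by
  unfold hyb
  refine Finset.sum_congr rfl fun i _ => ?_
  have h1 : (i : ℕ) < l := lt_of_lt_of_le i.isLt hl
  simp [h1, i.isLt]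

theorem hyb_mono (hmono : ∀ i ω, g i ω = true → g' i ω = true) : Monotone (hyb w g g' ω) := by
  refine monotone_nat_of_le_succ fun l => ?_
  by_cases hl : l < s
  · have := hyb_succ w g g' ω hmono ⟨l, hl⟩
    simp only at this
    rw [this]
    exact Nat.le_add_right _ _
  · push Not at hl
    rw [hyb_of_le w g g' ω hl, hyb_of_le w g g' ω (Nat.le_succ_of_le hl)]

/-- Crossing count of a monotone `ℕ`-sequence: it crosses `θ` upward at exactly one index iff it starts
below and ends at or above `θ`. -/
theorem crossing_count (Y : ℕ → ℕ) (hY : Monotone Y) (t : ℕ) :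
    ((Finset.range t).filter fun l => Y l < θ ∧ θ ≤ Y (l + 1)).card
      = if Y 0 < θ ∧ θ ≤ Y t then 1 else 0 := by
  induction t with
  | zero => simp
  | succ t ih =>
    rw [Finset.range_add_one, Finset.filter_insert]
    have hnot : t ∉ (Finset.range t).filter fun l => Y l < θ ∧ θ ≤ Y (l + 1) := by simp
    have h0t : Y 0 ≤ Y t := hY (Nat.zero_le t)
    have ht1 : Y t ≤ Y (t + 1) := hY (Nat.le_succ t)
    by_cases hc : Y t < θ ∧ θ ≤ Y (t + 1)
    · rw [if_pos hc, Finset.card_insert_of_notMem hnot, ih]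
      have h1 : ¬ (Y 0 < θ ∧ θ ≤ Y t) := fun h => absurd (lt_of_le_of_lt h.2 hc.1) (lt_irrefl _)
      have h2 : Y 0 < θ ∧ θ ≤ Y (t + 1) := ⟨lt_of_le_of_lt h0t hc.1, hc.2⟩
      rw [if_neg h1, if_pos h2]
    · rw [if_neg hc, ih]
      by_cases h : Y 0 < θ ∧ θ ≤ Y t
      · rw [if_pos h, if_pos ⟨h.1, h.2.trans ht1⟩]
      · rw [if_neg h]
        rw [if_neg]
        rintro ⟨ha, hb⟩
        rcases Nat.lt_or_ge (Y t) θ with hlt | hge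
        · exact hc ⟨hlt, hb⟩
        · exact h ⟨ha, hge⟩

/-- Pointwise form of the identity at `ω`. -/
theorem flip_indicator_eq (hmono : ∀ i ω, g i ω = true → g' i ω = true) :
    (if θ ≤ (∑ i : Fin s, if g' i ω then w i else 0) ∧ (∑ i : Fin s, if g i ω then w i else 0) < θ
      then 1 else 0)
    = ∑ l : Fin s, (if g l ω = false ∧ g' l ω = true ∧
          θ ≤ (∑ i : Fin s, if (if i < l then g' i ω else g i ω) then w i else 0) + w l ∧
          (∑ i : Fin s, if (if i < l then g' i ω else g i ω) then w i else 0) < θ then 1 else 0) := by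
  -- rewrite every hybrid as `hyb … l`
  have hQ : ∀ l : Fin s, (g l ω = false ∧ g' l ω = true ∧
        θ ≤ (∑ i : Fin s, if (if i < l then g' i ω else g i ω) then w i else 0) + w l ∧
        (∑ i : Fin s, if (if i < l then g' i ω else g i ω) then w i else 0) < θ)
      ↔ (hyb w g g' ω l < θ ∧ θ ≤ hyb w g g' ω (l + 1)) := by
    intro l
    have hs : (∑ i : Fin s, if (if i < l then g' i ω else g i ω) then w i else 0) = hyb w g g' ω l := by
      unfold hyb
      refine Finset.sum_congr rfl fun i _ => ?_
      rfl
    rw [hs, hyb_succ w g g' ω hmono l]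
    by_cases hf : g l ω = false ∧ g' l ω = true
    · simp only [hf, and_self, true_and, if_true]
      exact and_comm
    · rw [if_neg hf, add_zero]
      constructor
      · rintro ⟨h1, h2, _, _⟩
        exact absurd ⟨h1, h2⟩ hf
      · rintro ⟨h1, h2⟩
        exact absurd (lt_of_lt_of_le h1 h2) (lt_irrefl _)
  have hL : (θ ≤ (∑ i : Fin s, if g' i ω then w i else 0) ∧ (∑ i : Fin s, if g i ω then w i else 0) < θ)
      ↔ (hyb w g g' ω 0 < θ ∧ θ ≤ hyb w g g' ω s) := by
    rw [hyb_zero, hyb_top]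
    exact and_comm
  rw [if_congr hL rfl rfl]
  rw [Finset.sum_congr rfl fun l _ => if_congr (hQ l) rfl rfl]
  rw [Fin.sum_univ_eq_sum_range (fun l => if hyb w g g' ω l < θ ∧ θ ≤ hyb w g g' ω (l + 1) then 1 else 0) s]
  rw [← crossing_count θ (hyb w g g' ω) (hyb_mono w g g' ω hmono) s]
  rw [Finset.card_eq_sum_ones, Finset.sum_filter]

end FlipFlowProof

/-- **The flip-flow identity holds** (PROVED; pure counting). -/
theorem flipFlowIdentity_holds : FlipFlowIdentity := by
  intro Ω _ s θ w g g' hmono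
  rw [Finset.card_eq_sum_ones, Finset.sum_filter]
  simp_rw [Finset.card_eq_sum_ones, Finset.sum_filter]
  rw [Finset.sum_comm]
  refine Finset.sum_congr rfl fun ω _ => ?_
  exact flip_indicator_eq θ w g g' ω hmono

/-- **RUNG (read-once blindness)**: NO family of read-once weighted monotone threshold formulas strongly
detects the planted `⌈n^{1/2−δ}⌉`-clique in `G(n,1/2)` — with NO size hypothesis (read-once replaces it;
brute force `CLIQUE_{3 log n}` and guess-and-verify are not read-once, bipartite half-degree
(Kučera-strength, `k ≳ √(n log n)`) tests are). Intended proof: flip-flow identity ⇒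
`adv(F) = ½·E_A Σ_{e ⊆ E(A)} Π_{gates on the path of e} ā_g(A)` with INDEPENDENT hybrid atoms;
the unplanted atoms multiply to `Inf_e(F)`, so the unplanted benchmark is `½·(M/N)·I(F) ≤ 0.35·n^{−2δ}`
by `unate_sum_card_pivotal_le`; the planted/unplanted atom ratio at a gate is `≤ exp(O(z_g·ρ_g(A)))`,
`ρ_g` = planted shift of the sibling sum in units of its standard deviation, and `ρ_g(A) ≥ n^{−ε}` forces
`A` to concentrate on the vertices under `g` (probability `(k/n)^{Ω(1)}` per unit of shift). The SAME
room `n^{2δ}` as in BINC. -/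
def ReadOnceBlindAt (δ : ℝ) : Prop :=
  ∀ F : (n : ℕ) → TF n, (∀ᶠ n : ℕ in atTop, (F n).ReadOnce) →
    ¬ Tendsto (fun n => plantedAcc n (kOf δ n) (F n).eval - nullAcc n (F n).eval) atTop (nhds 1)

/-- The crux-level target of the card, beyond the rung: REUSE (fan-out / read-many) turns the independent
atoms into CONDITIONAL criticalities `κ_{g,l} = Pr[hybrid siblings critical | child l flips]`; the
identity stays exact, and guess-and-verify shows the only known way to make `κ` large where flip mass is
non-negligible: condition on `t` guessed clique vertices (flip mass `(k/n)^t`, fan-in `n^t`, boost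
`2^{t/2}` of the sibling SNR). `ConditionalCriticalityBudget c` records the conjectured budget for
size-`n^c` circuits in the weakest form the crux needs: along the clique-deletion path the flip flow into
the output stays `o(1)`, i.e. it is the crux itself written as a flow; the card's content is the
decomposition, not this restatement. -/
def ConditionalCriticalityBudget (δ : ℝ) (c : ℕ) : Prop :=
  ∀ C : (n : ℕ) → Circuit (Edge n), SmallMonotone c C →
    Tendsto (fun n => ignition n (kOf δ n) (C n).eval) atTop (nhds 0)

end Summit.PneNP.PneNP.Cruxes.MonotoneBlind.Ideas
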